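import Mathlib
import HarnessLib
import Summits.HubbardSuperconductivity.HubbardSuperconductivity.Theorems.KLProgrammeKLRegimeSplitTwoLegMultiSlot
import Summits.HubbardSuperconductivity.HubbardSuperconductivity.Theorems.KLProgrammeKLRegimeSplitStagePieces

/-!
# Route `KLProgramme` — child `KLRegimeCounterterm*` (`CountertermP2 klPreds* klWindowC`; gen-2 item stmt-HubbardSuperconductivity-19664):
# the SELF-MAP HALF of the wholesale counterterm iteration from (E3a-MS) multi-slot sizes — `frameOK_of_multiSlot`
# (seat hubbard-kl-k3c3-p2, technique «fixed point on FrameOK's tube (contraction in the frame norm)»; defect «Δ-stage»)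

Child 2 builds its frame as the WHOLESALE fixed point `K*_{(n)} = −Σ_{i≤n} ℓ_i(K*_{(n)})`, level by level (`n = 0, …, nScales β`), by finitely
many Picard steps `K ↦ Φ_n(K) := P^G(K) ⊖ D_n^G(K)` (`= −Σ_{i≤n} ℓ_i(K)` pointwise, `sum_eval_klTwoLegPieceG`).  Every iterate must be an
ADMISSIBLE frame (`FrameOK R U (nScales β) μ`), else the hypothesis block of `CountertermP2` says nothing about it.  Under the two-tier sizes
alone this was impossible at frames with fine structure (HOME/hubbard-kl-k3c3-p2/DEFECT-STAGE.md); with the multi-slot clause (E3a-MS)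
`TwoLegSizesMS` (`…SplitTwoLegMultiSlot`, p462472) it is elementary bookkeeping, done here once and for all, model-free:

* §1 finite sums of frames (`fadd`, `fsumR`) with their evaluation lemmas;
* §2 the AGGREGATED SLOT PIECES `msPiece lp n N m` = the scale-`m` part `lp m m` (if `m ≤ n`) plus the slot-`m` fine parts `lp i m` of the
  coarser pieces `i < m`, and the re-slotting identity `Σ_{i≤n} (lp i i + Σ_{m∈Ioc i N} lp i m) = Σ_{m≤N} msPiece … m`
  (`sum_multiSlot_eq_sum_msPiece`), hence `Φ_n(K) = −Σ_{m≤N} msPiece … m` (`eval_counterIter_eq_sum_msPiece`);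
* §3 the slot-`m` derivative bound `‖Dʲ msPiece … m‖ ≤ R.Gfr j·uPow j U·4^{(j−2)m}` from `twoLegBar j m ≤ ½·allowance` (room
  `2(S j + S′ j|U|) ≤ R.Gfr j`) and `Σ_{i≤n} msBar i ≤ ½` (`norm_iteratedFDeriv_msPiece_le`);
* §4 **`frameOK_of_multiSlot`**: (E3a-MS) at the pieces `i ≤ n`, the room condition, `Σ msBar ≤ ½` and the three small sums of slot
  allowances of orders `≤ 2` on the covariance window (the `c₁ / U₀` conditions) ⇒ `FrameOK R U (nScales β) μ (Φ_n K)` — via p2's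
  `frameOK_of_pieces` (…SplitStagePieces) with the aggregated pieces.  No coarse precondition on `K`.

Proofs only (plus the two sum-of-frames helpers); nothing is asserted about the Hubbard model.
-/

noncomputable section

namespace Summit.HubbardSuperconductivity.HubbardSuperconductivity.Theorems.KLRegimeSplit

set_option linter.dupNamespace false -- summit = problem name (single-conjunct summit), D-0017

open Real Finset
open Literature.MathematicalPhysics.QuantumLattice Literature.Probability.LatticeModels
open Summit.HubbardSuperconductivity.HubbardSuperconductivity.Theorems.KLProgrammeLegKernels

/-! ## §1 Finite sums of frames (the aggregated slot pieces are sums of the per-scale parts) -/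

/-- Sum of two frames (via `fsub`): `A ⊕ B := A ⊖ (0 ⊖ B)`. -/
def fadd (A B : TrigPolyC4v) : TrigPolyC4v := fsub A (fsub 0 B)

/-- `(A ⊕ B)(p) = A(p) + B(p)`. -/
theorem eval_fadd (A B : TrigPolyC4v) (p : Fin 2 → ℝ) : (fadd A B).eval p = A.eval p + B.eval p := by
  simp [fadd, eval_fsub]

/-- The frame `Σ_{i<k} f i` (iterated `fadd`). -/
def fsumR (f : ℕ → TrigPolyC4v) : ℕ → TrigPolyC4v
  | 0 => 0
  | k + 1 => fadd (fsumR f k) (f k)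

/-- `(Σ_{i<k} f i)(p) = Σ_{i<k} (f i)(p)`. -/
theorem eval_fsumR (f : ℕ → TrigPolyC4v) (k : ℕ) (p : Fin 2 → ℝ) :
    (fsumR f k).eval p = ∑ i ∈ range k, (f i).eval p := by
  induction k with
  | zero => simp [fsumR]
  | succ k ih => rw [fsumR, eval_fadd, ih, sum_range_succ]

/-- The same on `Momentum`, as functions. -/
theorem evalM_fsumR_eq (f : ℕ → TrigPolyC4v) (k : ℕ) :
    evalM (fsumR f k) = fun q => ∑ i ∈ range k, evalM (f i) q := by
  funext q
  exact eval_fsumR f k _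

/-- `evalM 0 = 0` as a function. -/
theorem evalM_zero_eq : evalM (0 : TrigPolyC4v) = fun _ => (0 : ℝ) := by
  funext q; simp [evalM]

/-- Evaluation commutes with `if`. -/
theorem eval_ite (c : Prop) [Decidable c] (A B : TrigPolyC4v) (p : Fin 2 → ℝ) :
    (if c then A else B).eval p = if c then A.eval p else B.eval p := by
  split_ifs <;> rfl

/-! ## §2 The aggregated slot pieces of `−Σ_{i≤n} ℓ_i(K)` -/

/-- **The slot-`m` piece of the wholesale counterterm iterate at level `n`**, assembled from multi-slot decompositions
`lp i : ℕ → TrigPolyC4v` of the scale-`i` pieces (`i ≤ n`): the scale-`m` part `lp m m` (if `m ≤ n`) plus the slot-`m` fine parts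
`lp i m` of the coarser pieces `i < m` (`m ≤ N`). -/
def msPiece (lp : ℕ → ℕ → TrigPolyC4v) (n N m : ℕ) : TrigPolyC4v :=
  fsumR (fun i => if m ∈ insert i (Ioc i N) then lp i m else 0) (n + 1)

/-- Evaluation of the aggregated slot piece. -/
theorem eval_msPiece (lp : ℕ → ℕ → TrigPolyC4v) (n N m : ℕ) (p : Fin 2 → ℝ) :
    (msPiece lp n N m).eval p = ∑ i ∈ range (n + 1), if m ∈ insert i (Ioc i N) then (lp i m).eval p else 0 := by
  rw [msPiece, eval_fsumR]
  refine sum_congr rfl fun i _ => ?_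
  rw [eval_ite, TrigPolyC4v.eval_zero]

/-- **Re-slotting identity**: summing the multi-slot decompositions of the pieces `i ≤ n` scale by scale equals summing the aggregated
slot pieces slot by slot (`n ≤ N`). -/
theorem sum_multiSlot_eq_sum_msPiece (lp : ℕ → ℕ → TrigPolyC4v) {n N : ℕ} (hn : n ≤ N) (p : Fin 2 → ℝ) :
    ∑ i ∈ range (n + 1), ((lp i i).eval p + ∑ m ∈ Ioc i N, (lp i m).eval p) =
      ∑ m ∈ range (N + 1), (msPiece lp n N m).eval p := by
  simp_rw [eval_msPiece]
  rw [sum_comm]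
  refine sum_congr rfl fun i hi => ?_
  have hiN : i ≤ N := (Nat.lt_succ_iff.mp (mem_range.mp hi)).trans hn
  have hsub : insert i (Ioc i N) ⊆ range (N + 1) := by
    intro m hm
    rcases mem_insert.mp hm with rfl | hm
    · exact mem_range.mpr (Nat.lt_succ_of_le hiN)
    · exact mem_range.mpr (Nat.lt_succ_of_le (mem_Ioc.mp hm).2)
  rw [← sum_filter, filter_mem_eq_inter, (inter_eq_right.mpr hsub), sum_insert]
  exact fun h => (lt_irrefl i) (mem_Ioc.mp h).1

section Model

variable {L M : ℕ} [NeZero L] [NeZero M]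

/-- **The wholesale iterate `P^G(K) ⊖ D_n^G(K) = −Σ_{i≤n} ℓ_i(K)` is the negative sum of the aggregated slot pieces** (the `hsumE` input
of `frameOK_of_pieces`), given multi-slot decompositions `lp i` of the pieces `i ≤ n ≤ N`. -/
theorem eval_counterIter_eq_sum_msPiece {β U μ : ℝ} {K : TrigPolyC4v} {n : ℕ} (hn : n ≤ nScales β) {lp : ℕ → ℕ → TrigPolyC4v}
    (hlp : ∀ i ≤ n, ∀ p : Fin 2 → ℝ,
      (klTwoLegPieceG L M β U μ K i).eval p = (lp i i).eval p + ∑ m ∈ Ioc i (nScales β), (lp i m).eval p)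
    (p : Fin 2 → ℝ) :
    (fsub (klFrameProjG L μ K) (klTwoLegPolyG L M β U μ K n)).eval p =
      ∑ m ∈ range (nScales β + 1), (fsub 0 (msPiece lp n (nScales β) m)).eval p := by
  have htel := sum_eval_klTwoLegPieceG L M β U μ K n p
  have hdec : ∑ i ∈ range (n + 1), (klTwoLegPieceG L M β U μ K i).eval p =
      ∑ i ∈ range (n + 1), ((lp i i).eval p + ∑ m ∈ Ioc i (nScales β), (lp i m).eval p) :=
    sum_congr rfl fun i hi => hlp i (Nat.lt_succ_iff.mp (mem_range.mp hi)) p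
  simp only [eval_fsub, TrigPolyC4v.eval_zero, zero_sub, sum_neg_distrib]
  rw [← sum_multiSlot_eq_sum_msPiece lp hn p, ← hdec, htel]
  ring

end Model

/-! ## §3 Derivative bounds of the aggregated slot pieces -/

/-- **Slot-`m` bound of the aggregated piece**: if the scale-`m` part obeys `twoLegBar G Q U j m` and every fine part `lp i m` (`i < m ≤ N`)
obeys `msBar G Q U i · A` with `A = R.Gfr j·uPow j U·4^{(j-2)m}`, and `2·(S j + S′ j|U|) ≤ R.Gfr j`, `Σ_{i≤n} msBar i ≤ ½`, then the aggregated
slot-`m` piece obeys the slot allowance `A`. -/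
theorem norm_iteratedFDeriv_msPiece_le {G : GeoConsts} {Q : EngConsts} {R : RenConsts} (hG : G.WF) (hQ : Q.WF)
    (hR : ∀ j, 0 ≤ R.Gfr j) {U : ℝ} {lp : ℕ → ℕ → TrigPolyC4v} {n N m j : ℕ}
    (hdiag : m ≤ n → ∀ q : Momentum, ‖iteratedFDeriv ℝ j (evalM (lp m m)) q‖ ≤ twoLegBar G Q U j m)
    (hfine : ∀ i ≤ n, m ∈ Ioc i N → ∀ q : Momentum,
      ‖iteratedFDeriv ℝ j (evalM (lp i m)) q‖ ≤ msBar G Q U i * (R.Gfr j * uPow j U * (4 : ℝ) ^ (((j : ℤ) - 2) * m)))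
    (ha : 2 * (G.S j + Q.S' j * |U|) ≤ R.Gfr j) (hb : ∑ i ∈ range (n + 1), msBar G Q U i ≤ 1 / 2) (q : Momentum) :
    ‖iteratedFDeriv ℝ j (evalM (msPiece lp n N m)) q‖ ≤ R.Gfr j * uPow j U * (4 : ℝ) ^ (((j : ℤ) - 2) * m) := by
  set A : ℝ := R.Gfr j * uPow j U * (4 : ℝ) ^ (((j : ℤ) - 2) * m) with hA_def
  have hA : 0 ≤ A := mul_nonneg (mul_nonneg (hR j) (uPow_nonneg j U)) (zpow_nonneg (by norm_num) _)
  have hms : ∀ i, 0 ≤ msBar G Q U i := fun i => msBar_nonneg hG hQ U i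
  -- the aggregated piece as a sum of functions
  have hfun : evalM (msPiece lp n N m) =
      fun q => ∑ i ∈ range (n + 1), evalM (if m ∈ insert i (Ioc i N) then lp i m else 0) q := by
    rw [msPiece, evalM_fsumR_eq]
  rw [hfun, iteratedFDeriv_fun_sum_apply fun i _ => (contDiff_evalM _).contDiffAt]
  refine (norm_sum_le _ _).trans ?_
  -- termwise bound
  have hterm : ∀ i ∈ range (n + 1),
      ‖iteratedFDeriv ℝ j (evalM (if m ∈ insert i (Ioc i N) then lp i m else 0)) q‖ ≤
        (if i = m then twoLegBar G Q U j m else 0) + msBar G Q U i * A := by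
    intro i hi
    have hin : i ≤ n := Nat.lt_succ_iff.mp (mem_range.mp hi)
    by_cases hc : m ∈ insert i (Ioc i N)
    · rw [if_pos hc]
      rcases mem_insert.mp hc with hmi | hIoc
      · subst hmi
        rw [if_pos rfl]
        have := hdiag hin q
        nlinarith [hms m, hA]
      · have hne : i ≠ m := fun h => by subst h; exact (lt_irrefl i) (mem_Ioc.mp hIoc).1
        rw [if_neg hne, zero_add]
        exact hfine i hin hIoc q
    · rw [if_neg hc, evalM_zero_eq, iteratedFDeriv_fun_zero]
      simp only [Pi.zero_apply, norm_zero]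
      have h1 : 0 ≤ (if i = m then twoLegBar G Q U j m else 0) := by
        split_ifs
        · exact twoLegBar_nonneg' hG hQ U j m
        · exact le_rfl
      nlinarith [hms i, hA]
  refine (sum_le_sum hterm).trans ?_
  rw [sum_add_distrib, ← sum_mul]
  -- the diagonal term
  have hdiagsum : ∑ i ∈ range (n + 1), (if i = m then twoLegBar G Q U j m else 0) ≤ A / 2 := by
    rw [sum_ite_eq' (range (n + 1)) m]
    have htlb : twoLegBar G Q U j m ≤ A / 2 := by
      rw [hA_def]
      unfold twoLegBar
      have h4 : 0 ≤ uPow j U * (4 : ℝ) ^ (((j : ℤ) - 2) * m) := mul_nonneg (uPow_nonneg j U) (zpow_nonneg (by norm_num) _)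
      nlinarith
    split_ifs
    · exact htlb
    · linarith
  have hfinesum : (∑ i ∈ range (n + 1), msBar G Q U i) * A ≤ 1 / 2 * A := mul_le_mul_of_nonneg_right hb hA
  linarith

section Model

variable {L M : ℕ} [NeZero L] [NeZero M]

/-- **SELF-MAP FROM MULTI-SLOT SIZES** (child 2's use of (E3a-MS), no coarse precondition): if the pieces `ℓ_i(K)`, `i ≤ n ≤ N = nScales β`,
satisfy `TwoLegSizesMS … K i`, the renormalisation package gives room (`2(S j + S′ j|U|) ≤ R.Gfr j`, `j ≤ 4`), the multi-slot factors sum to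
`≤ ½`, and the slot allowances of orders `≤ 2` sum small on the covariance window (the `c₁ / U₀` conditions of `CtOneVolume`), then the
wholesale counterterm iterate `P^G(K) ⊖ D_n^G(K) = −Σ_{i≤n} ℓ_i(K)` is an ADMISSIBLE frame: `FrameOK R U (nScales β) μ (…)`. -/
theorem frameOK_of_multiSlot {G : GeoConsts} {Q : EngConsts} {R : RenConsts} (hG : G.WF) (hQ : Q.WF) (hR : ∀ j, 0 ≤ R.Gfr j)
    {β U μ : ℝ} {K : TrigPolyC4v} {n : ℕ} (hn : n ≤ nScales β) (hμ : μ ∈ Set.Icc (-1.05 : ℝ) (-0.15))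
    (hMS : ∀ i ≤ n, TwoLegSizesMS L M G Q R β U μ K i)
    (ha : ∀ j ≤ 4, 2 * (G.S j + Q.S' j * |U|) ≤ R.Gfr j)
    (hb : ∑ i ∈ range (n + 1), msBar G Q U i ≤ 1 / 2)
    (h0 : ∑ m ∈ range (nScales β + 1), R.Gfr 0 * uPow 0 U * (4 : ℝ) ^ (((0 : ℤ) - 2) * m) ≤ 3 / 80)
    (h1 : ∑ m ∈ range (nScales β + 1), R.Gfr 1 * uPow 1 U * (4 : ℝ) ^ (((1 : ℤ) - 2) * m) ≤ 1 / 2000)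
    (h2 : ∑ m ∈ range (nScales β + 1), ∑ j ∈ range 3, R.Gfr j * uPow j U * (4 : ℝ) ^ (((j : ℤ) - 2) * m) ≤ 1 / 100) :
    FrameOK R U (nScales β) μ (fsub (klFrameProjG L μ K) (klTwoLegPolyG L M β U μ K n)) := by
  classical
  -- choose the multi-slot decompositions of the pieces `i ≤ n` (anything beyond `n` is irrelevant: take `0`)
  have hch : ∀ i, ∃ lp : ℕ → TrigPolyC4v, i ≤ n →
      (∀ p : Fin 2 → ℝ,
          (klTwoLegPieceG L M β U μ K i).eval p = (lp i).eval p + ∑ m ∈ Ioc i (nScales β), (lp m).eval p) ∧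
      (∀ j ≤ 4, ∀ q : Momentum, ‖iteratedFDeriv ℝ j (evalM (lp i)) q‖ ≤ twoLegBar G Q U j i) ∧
      (∀ m ∈ Ioc i (nScales β), ∀ j ≤ 4, ∀ q : Momentum,
          ‖iteratedFDeriv ℝ j (evalM (lp m)) q‖ ≤ msBar G Q U i * (R.Gfr j * uPow j U * (4 : ℝ) ^ (((j : ℤ) - 2) * m))) := by
    intro i
    by_cases hi : i ≤ n
    · obtain ⟨lp, h⟩ := hMS i hi
      exact ⟨lp, fun _ => h⟩
    · exact ⟨fun _ => 0, fun h => absurd h hi⟩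
  choose lp hlp using hch
  refine frameOK_of_pieces hR hμ (Kp := fun m => msPiece lp n (nScales β) m)
    (eval_counterIter_eq_sum_msPiece (L := L) (M := M) hn (fun i hi => (hlp i hi).1)) ?_ h0 h1 h2
  intro m _ j hj q
  exact norm_iteratedFDeriv_msPiece_le hG hQ hR
    (fun hmn q => (hlp m hmn).2.1 j hj q)
    (fun i hi hIoc q => (hlp i hi).2.2 m hIoc j hj q) (ha j hj) hb q

end Model


/-! ## §5 The self-map with the SHARP room condition (what `ctRen G`, `Gfr j = G.S j + 1`, affords)

The room needed by the fine parts is only `(Σ_{i≤n} msBar i)·R.Gfr j`, which vanishes with `U`; so instead of `2(S j + S′ j|U|) ≤ R.Gfr j`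
(§3–§4) the sharp condition `G.S j + Q.S′ j·|U| + (Σ_{i≤n} msBar G Q U i)·R.Gfr j ≤ R.Gfr j` suffices — met by child 2's package of record
`ctRen G` (`Gfr j = G.S j + 1`) as soon as `Q.S′ j·|U| + (Σ msBar)·(G.S j + 1) ≤ 1`, a `U₀(Q)` condition. -/

/-- **Slot-`m` bound of the aggregated piece, sharp room**: as `norm_iteratedFDeriv_msPiece_le`, with the single room condition
`G.S j + Q.S′ j·|U| + (Σ_{i≤n} msBar i)·R.Gfr j ≤ R.Gfr j`. -/
theorem norm_iteratedFDeriv_msPiece_le' {G : GeoConsts} {Q : EngConsts} {R : RenConsts} (hG : G.WF) (hQ : Q.WF)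
    (hR : ∀ j, 0 ≤ R.Gfr j) {U : ℝ} {lp : ℕ → ℕ → TrigPolyC4v} {n N m j : ℕ}
    (hdiag : m ≤ n → ∀ q : Momentum, ‖iteratedFDeriv ℝ j (evalM (lp m m)) q‖ ≤ twoLegBar G Q U j m)
    (hfine : ∀ i ≤ n, m ∈ Ioc i N → ∀ q : Momentum,
      ‖iteratedFDeriv ℝ j (evalM (lp i m)) q‖ ≤ msBar G Q U i * (R.Gfr j * uPow j U * (4 : ℝ) ^ (((j : ℤ) - 2) * m)))
    (hroom : G.S j + Q.S' j * |U| + (∑ i ∈ range (n + 1), msBar G Q U i) * R.Gfr j ≤ R.Gfr j) (q : Momentum) :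
    ‖iteratedFDeriv ℝ j (evalM (msPiece lp n N m)) q‖ ≤ R.Gfr j * uPow j U * (4 : ℝ) ^ (((j : ℤ) - 2) * m) := by
  set A : ℝ := R.Gfr j * uPow j U * (4 : ℝ) ^ (((j : ℤ) - 2) * m) with hA_def
  set W : ℝ := uPow j U * (4 : ℝ) ^ (((j : ℤ) - 2) * m) with hW_def
  have hW : 0 ≤ W := mul_nonneg (uPow_nonneg j U) (zpow_nonneg (by norm_num) _)
  have hA : 0 ≤ A := mul_nonneg (mul_nonneg (hR j) (uPow_nonneg j U)) (zpow_nonneg (by norm_num) _)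
  have hAW : A = R.Gfr j * W := by rw [hA_def, hW_def]; ring
  have hms : ∀ i, 0 ≤ msBar G Q U i := fun i => msBar_nonneg hG hQ U i
  have hfun : evalM (msPiece lp n N m) =
      fun q => ∑ i ∈ range (n + 1), evalM (if m ∈ insert i (Ioc i N) then lp i m else 0) q := by
    rw [msPiece, evalM_fsumR_eq]
  rw [hfun, iteratedFDeriv_fun_sum_apply fun i _ => (contDiff_evalM _).contDiffAt]
  refine (norm_sum_le _ _).trans ?_
  have hterm : ∀ i ∈ range (n + 1),
      ‖iteratedFDeriv ℝ j (evalM (if m ∈ insert i (Ioc i N) then lp i m else 0)) q‖ ≤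
        (if i = m then twoLegBar G Q U j m else 0) + msBar G Q U i * A := by
    intro i hi
    have hin : i ≤ n := Nat.lt_succ_iff.mp (mem_range.mp hi)
    by_cases hc : m ∈ insert i (Ioc i N)
    · rw [if_pos hc]
      rcases mem_insert.mp hc with hmi | hIoc
      · subst hmi
        rw [if_pos rfl]
        have := hdiag hin q
        nlinarith [hms m, hA]
      · have hne : i ≠ m := fun h => by subst h; exact (lt_irrefl i) (mem_Ioc.mp hIoc).1
        rw [if_neg hne, zero_add]
        exact hfine i hin hIoc q
    · rw [if_neg hc, evalM_zero_eq, iteratedFDeriv_fun_zero]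
      simp only [Pi.zero_apply, norm_zero]
      have h1 : 0 ≤ (if i = m then twoLegBar G Q U j m else 0) := by
        split_ifs
        · exact twoLegBar_nonneg' hG hQ U j m
        · exact le_rfl
      nlinarith [hms i, hA]
  refine (sum_le_sum hterm).trans ?_
  rw [sum_add_distrib, ← sum_mul]
  -- the diagonal term is at most `twoLegBar j m = (S j + S′ j|U|)·W`
  have hdiagsum : ∑ i ∈ range (n + 1), (if i = m then twoLegBar G Q U j m else 0) ≤ (G.S j + Q.S' j * |U|) * W := by
    rw [sum_ite_eq' (range (n + 1)) m]
    have htlb : twoLegBar G Q U j m = (G.S j + Q.S' j * |U|) * W := by rw [hW_def]; unfold twoLegBar; ring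
    split_ifs
    · exact htlb.le
    · have hS : 0 ≤ G.S j := hG.2.2.2.2.2.2.2.2.2.2.2.2.2.2.2.2.2.1 j
      have hS' : 0 ≤ Q.S' j := hQ.2.2.2.2.1 j
      positivity
  -- room
  have hroomW : ((G.S j + Q.S' j * |U|) + (∑ i ∈ range (n + 1), msBar G Q U i) * R.Gfr j) * W ≤ R.Gfr j * W :=
    mul_le_mul_of_nonneg_right hroom hW
  have hsplit : (G.S j + Q.S' j * |U|) * W + (∑ i ∈ range (n + 1), msBar G Q U i) * A =
      ((G.S j + Q.S' j * |U|) + (∑ i ∈ range (n + 1), msBar G Q U i) * R.Gfr j) * W := by rw [hAW]; ring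
  rw [hAW]
  linarith

section Model

variable {L M : ℕ} [NeZero L] [NeZero M]

/-- **SELF-MAP FROM MULTI-SLOT SIZES, sharp room** (the form child 2 uses with its package of record `ctRen G`, `Gfr j = G.S j + 1`):
as `frameOK_of_multiSlot`, with the room conditions replaced by `∀ j ≤ 4, G.S j + Q.S′ j·|U| + (Σ_{i≤n} msBar G Q U i)·R.Gfr j ≤ R.Gfr j`. -/
theorem frameOK_of_multiSlot' {G : GeoConsts} {Q : EngConsts} {R : RenConsts} (hG : G.WF) (hQ : Q.WF) (hR : ∀ j, 0 ≤ R.Gfr j)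
    {β U μ : ℝ} {K : TrigPolyC4v} {n : ℕ} (hn : n ≤ nScales β) (hμ : μ ∈ Set.Icc (-1.05 : ℝ) (-0.15))
    (hMS : ∀ i ≤ n, TwoLegSizesMS L M G Q R β U μ K i)
    (hroom : ∀ j ≤ 4, G.S j + Q.S' j * |U| + (∑ i ∈ range (n + 1), msBar G Q U i) * R.Gfr j ≤ R.Gfr j)
    (h0 : ∑ m ∈ range (nScales β + 1), R.Gfr 0 * uPow 0 U * (4 : ℝ) ^ (((0 : ℤ) - 2) * m) ≤ 3 / 80)
    (h1 : ∑ m ∈ range (nScales β + 1), R.Gfr 1 * uPow 1 U * (4 : ℝ) ^ (((1 : ℤ) - 2) * m) ≤ 1 / 2000)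
    (h2 : ∑ m ∈ range (nScales β + 1), ∑ j ∈ range 3, R.Gfr j * uPow j U * (4 : ℝ) ^ (((j : ℤ) - 2) * m) ≤ 1 / 100) :
    FrameOK R U (nScales β) μ (fsub (klFrameProjG L μ K) (klTwoLegPolyG L M β U μ K n)) := by
  classical
  have hch : ∀ i, ∃ lp : ℕ → TrigPolyC4v, i ≤ n →
      (∀ p : Fin 2 → ℝ,
          (klTwoLegPieceG L M β U μ K i).eval p = (lp i).eval p + ∑ m ∈ Ioc i (nScales β), (lp m).eval p) ∧
      (∀ j ≤ 4, ∀ q : Momentum, ‖iteratedFDeriv ℝ j (evalM (lp i)) q‖ ≤ twoLegBar G Q U j i) ∧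
      (∀ m ∈ Ioc i (nScales β), ∀ j ≤ 4, ∀ q : Momentum,
          ‖iteratedFDeriv ℝ j (evalM (lp m)) q‖ ≤ msBar G Q U i * (R.Gfr j * uPow j U * (4 : ℝ) ^ (((j : ℤ) - 2) * m))) := by
    intro i
    by_cases hi : i ≤ n
    · obtain ⟨lp, h⟩ := hMS i hi
      exact ⟨lp, fun _ => h⟩
    · exact ⟨fun _ => 0, fun h => absurd h hi⟩
  choose lp hlp using hch
  refine frameOK_of_pieces hR hμ (Kp := fun m => msPiece lp n (nScales β) m)
    (eval_counterIter_eq_sum_msPiece (L := L) (M := M) hn (fun i hi => (hlp i hi).1)) ?_ h0 h1 h2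
  intro m _ j hj q
  exact norm_iteratedFDeriv_msPiece_le' hG hQ hR
    (fun hmn q => (hlp m hmn).2.1 j hj q)
    (fun i hi hIoc q => (hlp i hi).2.2 m hIoc j hj q) (hroom j hj) q

/-- **The room condition for child 2's package of record** `Gfr j = G.S j + 1`: it reads `Q.S′ j·|U| + (Σ_{i≤n} msBar i)·(G.S j + 1) ≤ 1`. -/
theorem room_of_ctRen_shape {G : GeoConsts} {Q : EngConsts} {R : RenConsts} {U : ℝ} {n j : ℕ} (hGfr : R.Gfr j = G.S j + 1)
    (h : Q.S' j * |U| + (∑ i ∈ range (n + 1), msBar G Q U i) * (G.S j + 1) ≤ 1) :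
    G.S j + Q.S' j * |U| + (∑ i ∈ range (n + 1), msBar G Q U i) * R.Gfr j ≤ R.Gfr j := by
  rw [hGfr]; linarith

end Model

end Summit.HubbardSuperconductivity.HubbardSuperconductivity.Theorems.KLRegimeSplit

end
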